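import Literature.AlgebraicGeometry.Resolution.NormalizationInExtension
import Literature.AlgebraicGeometry.Resolution.Temkin2008Localization
import Literature.AlgebraicGeometry.Resolution.ProOpenIdealExtension
import Literature.AlgebraicGeometry.Resolution.BlowupsFlatBaseChange
import Literature.AlgebraicGeometry.Resolution.BlowupsExistence
import Literature.AlgebraicGeometry.Resolution.BlowupsLocal
import Summits.ResolutionOfSingularities.ResolutionOfSingularities.Theorems.PAlterationPicoverLocalBlowups
import HarnessLib

/-!
# Crux `Picover` (stmt-ResolutionOfSingularities-0554), line `degree-p-tower`: the kernel
# `stub_picoverKernel` is implied by Temkin-strong resolution of characteristic-`p` varieties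

Route `ResolutionOfSingularities/pAlteration`, crux `Picover`, line `degree-p-tower` (lead a3,
2026-08-17). Support file (`--supports stmt-ResolutionOfSingularities-0554`).

After the reshape of the line's skeleton (`Cruxes/Picover/Lines/degree_p_tower.lean`) its one
research stub is the KERNEL `stub_picoverKernel`: at a singular point `x` of local dimension
`≥ 4` of the normalization `W^L` of a regular variety `W` in a degree-`p` purely inseparable
extension `L` of `K(W)`, every blow-up `S'` of `Spec 𝒪_{W^L,x}` singular only over `x` admits a
desingularization in Temkin's sense (`Scheme.AdmitsDesingularization`: ONE blow-up along an
ideal sheaf co-supported in `S' ∖ Reg S'`, with regular source). Because it asks for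
`Sing`-supported BLOW-UPS, the kernel is not known to follow from the weak summit
(`Scheme.HasResolution`); this file records exactly what it does follow from, for the
disprover and the planners (stub plan `STUB-PLAN-stub_picoverDegP.md` §4 K3):

* `admitsDesingularization_of_iso` — desingularizations transport along isomorphisms.
* `admitsDesingularization_of_isBlowup_stalk` — **Temkin 2008, Prop. 2.3.4, the easy converse
  (ii)⇒(iii), per scheme**: if every blow-up of a locally Noetherian scheme `X` admits a
  desingularization, then so does every blow-up `S'` of every local scheme `Spec 𝒪_{X,x}`.
  Proof: the blown-up ideal `I` of `𝒪_{X,x}` extends to an ideal sheaf `J` of `X`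
  (Temkin 2008, Lemma 2.1.1, in tree); `S' ≅ Bl_J X ×_X Spec 𝒪_{X,x}` (blow-ups commute with
  the flat base change `Spec 𝒪_{X,x} → X`, uniqueness of blow-ups); a desingularization
  `X₂ → Bl_J X` base-changes to a blow-up of `S'` whose centre lies over `Sing (Bl_J X)`, i.e. in
  `Sing S'`, and whose source is regular, local rings being unchanged along the pro-open
  immersions `(-) ×_X Spec 𝒪_{X,x} → (-)`.
* `picoverKernel_of_resolutionOver` — **the kernel from Temkin-strong resolution in
  characteristic `p`**: if for every prime `p` and every field `k` of characteristic `p` there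
  is resolution of singularities over `Spec k` in Temkin's sense (`ResolutionOver (Spec k)`:
  every integral `k`-scheme of finite type admits a desingularization), then the registered
  kernel `stub_picoverKernel` holds (verbatim signature) — indeed with its hypotheses
  "`x` singular", "local dimension `≥ 4`", "`S'` singular only over `x`", "`W` regular",
  "`L/K(W)` purely inseparable" all idle: every blow-up of every local scheme of `W^L` admits a
  desingularization, `W^L` being an integral `k`-scheme of finite type.
* `picoverDegP_of_localBlowups_allDims` — the FACT-FREE variant of the reduction: if Temkin's
  local hypothesis is granted at ALL singular points of `W^L` (every local dimension), the
  residue `stub_picoverDegP` follows from the landed per-scheme localisation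
  `admitsDesingularization_of_localBlowups_over_field` alone (no Cossart–Piltant, no
  Cossart–Jannsen–Saito), for planners who prefer one research stub and no named facts.

So the kernel is sandwiched: Temkin-strong resolution of `p`-cover varieties ⟹ kernel ⟹ (with
CP 2019 Thm 1.1 + Prop 4.4 and CJS 2020 Thm 1.2, `KernelReduction.stub_picoverDegP_of_facts_and_kernel`)
residue ⟺ crux ⟸ summit. A refutation of the kernel is a 4-fold purely inseparable `p`-cover germ
one of whose local blow-ups has NO `Sing`-supported blow-up desingularization — in particular a
counterexample to resolution "by a blow-up with centre over the singular locus" in dimension `4`.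

No new definitions. [cite: Temkin2008, Prop. 2.3.4, Lemma 2.1.1, Def. 2.3.1]
[cite: GortzWedhorn2020, Prop. 13.91 (2)]
-/

noncomputable section

open CategoryTheory CategoryTheory.Limits AlgebraicGeometry TopologicalSpace IsLocalRing
open Literature.AlgebraicGeometry.Resolution

set_option linter.dupNamespace false -- mandated namespace of this single-conjunct summit

namespace Summit.ResolutionOfSingularities.ResolutionOfSingularities.Theorems.Picover.KernelHonesty

universe u

/-! ## Transport of desingularizations along isomorphisms -/

/-- **Desingularizations transport along isomorphisms of schemes**: if `X` admits a
desingularization `π : X' → X` (a blow-up along `J` co-supported in `X ∖ Reg X`, `X'` regular)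
and `e : X ≅ Y`, then `π ≫ e.hom` is a blow-up of `Y` along `e⁻¹J`, co-supported in `Y ∖ Reg Y`.
[folklore] -/
theorem admitsDesingularization_of_iso
    {X Y : Scheme.{u}} (h : Scheme.AdmitsDesingularization X) (e : X ≅ Y) :
    Scheme.AdmitsDesingularization Y := by
  obtain ⟨X', π, ⟨J, hπ, hJ⟩, hreg⟩ := h
  refine ⟨X', π ≫ e.hom, ⟨J.comap e.inv, hπ.comp_iso e, fun y hy => ?_⟩, hreg⟩
  rw [Scheme.IdealSheafData.support_comap] at hy
  have hy' : e.inv y ∈ (J.support : Set X) := hy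
  have hreg' := hJ hy'
  intro hyreg
  exact hreg' ((mem_regularLocus_iff_of_flat_of_isPreimmersion e.inv y).mp hyreg)

/-! ## Blow-ups of local schemes are base changes of blow-ups (Temkin 2008, Prop. 2.3.4 (ii)⇒(iii)) -/

/-- **Temkin 2008, Prop. 2.3.4, converse direction (ii)⇒(iii), per scheme.** Let `X` be a
locally Noetherian scheme all of whose blow-ups admit a desingularization (a `Sing`-supported
blow-up with regular source). Then for every point `x ∈ X`, every blow-up `g : S' → Spec 𝒪_{X,x}`
of the local scheme admits a desingularization. Proof: extend the blown-up ideal sheaf `I` to an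
ideal sheaf `J` on `X` with `ι⁻¹J 𝒪 = I` for `ι : Spec 𝒪_{X,x} → X` (Temkin's Lemma 2.1.1,
`exists_idealSheaf_extension_fromSpecStalk`); `ι` is flat, so `Bl_J X ×_X Spec 𝒪_{X,x}` is a
blow-up of `Spec 𝒪_{X,x}` along `I` (Görtz–Wedhorn 13.91 (2)), hence isomorphic to `S'`; a
desingularization of `Bl_J X` pulls back along the flat pro-open immersion
`Bl_J X ×_X Spec 𝒪_{X,x} → Bl_J X` to a blow-up with regular source whose centre lies over the
singular locus, local rings being unchanged along such morphisms.
[cite: Temkin2008, Prop. 2.3.4, Lemma 2.1.1] [cite: GortzWedhorn2020, Prop. 13.91 (2)] -/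
theorem admitsDesingularization_of_isBlowup_stalk {X : Scheme.{u}} [IsLocallyNoetherian X]
    (hX : ∀ (X₁ : Scheme.{u}) (b : X₁ ⟶ X) (J : X.IdealSheafData), IsBlowup b J →
      Scheme.AdmitsDesingularization X₁)
    (x : X) {S' : Scheme.{u}} {g : S' ⟶ Spec (X.presheaf.stalk x)}
    {I : (Spec (X.presheaf.stalk x)).IdealSheafData} (hg : IsBlowup g I) :
    Scheme.AdmitsDesingularization S' := by
  classical
  haveI : Flat (X.fromSpecStalk x) := flat_fromSpecStalk X x
  -- the local scheme as the fibre product `X ×_X Spec 𝒪_{X,x}`, to use Lemma 2.1.1 as vendored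
  haveI : IsNoetherian (pullback (𝟙 X) (X.fromSpecStalk x)) := {}
  obtain ⟨J, hJ, -⟩ := exists_idealSheaf_extension_fromSpecStalk (𝟙 X) x
    (I.comap (pullback.snd (𝟙 X) (X.fromSpecStalk x)))
  -- `ι⁻¹ J = I`
  have hJι : J.comap (X.fromSpecStalk x) = I := by
    have h1 : pullback.fst (𝟙 X) (X.fromSpecStalk x) =
        pullback.snd (𝟙 X) (X.fromSpecStalk x) ≫ X.fromSpecStalk x := by
      simpa using pullback.condition (f := 𝟙 X) (g := X.fromSpecStalk x)
    rw [h1, Scheme.IdealSheafData.comap_comp] at hJ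
    have h2 := congrArg (fun K => K.comap (inv (pullback.snd (𝟙 X) (X.fromSpecStalk x)))) hJ
    simpa only [← Scheme.IdealSheafData.comap_comp, IsIso.inv_hom_id_assoc, IsIso.inv_hom_id,
      Scheme.IdealSheafData.comap_id] using h2
  -- blow `X` up along `J` and desingularize the blow-up
  obtain ⟨X₁, b, hb⟩ := exists_isBlowup X J
  obtain ⟨X₂, d, hd⟩ := hX X₁ b J hb
  obtain ⟨J₂, hdJ₂, hsupp⟩ := hd.exists_isBlowup
  -- `S' ≅ X₁ ×_X Spec 𝒪_{X,x}` over `Spec 𝒪_{X,x}`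
  have hb₁ : IsBlowup (pullback.snd b (X.fromSpecStalk x)) I :=
    hJι ▸ hb.pullback_snd_of_flat (X.fromSpecStalk x)
  obtain ⟨e, -, -⟩ := hg.unique hb₁
  -- the desingularization of `X₁` pulled back along the flat pro-open immersion `X₁ ×_X S → X₁`
  set f₁ := pullback.fst b (X.fromSpecStalk x) with hf₁
  have hd₁ : IsBlowup (pullback.snd d f₁) (J₂.comap f₁) := hdJ₂.pullback_snd_of_flat f₁
  have hP : Scheme.AdmitsDesingularization (pullback b (X.fromSpecStalk x)) := by
    refine ⟨_, pullback.snd d f₁, ⟨J₂.comap f₁, hd₁, fun s hs => ?_⟩, fun t => ?_⟩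
    · rw [Scheme.IdealSheafData.support_comap] at hs
      have hs' : f₁ s ∈ (J₂.support : Set X₁) := hs
      intro hsreg
      exact hsupp hs' ((mem_regularLocus_iff_pullback_fst_fromSpecStalk b x s).mp hsreg)
    · have ht : pullback.fst d f₁ t ∈ Scheme.regularLocus X₂ := hd.isRegular _
      exact (Scheme.mem_regularLocus t).mp
        ((mem_regularLocus_iff_of_flat_of_isPreimmersion (pullback.fst d f₁) t).mpr ht)
  exact admitsDesingularization_of_iso hP e.symm

/-! ## The kernel from Temkin-strong resolution of characteristic-`p` varieties -/

/-- **Every blow-up of every local scheme of an integral variety admits a desingularization,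
granted resolution of singularities over the ground field in Temkin's sense.** For `k` a field
with `ResolutionOver (Spec k)` (every integral `k`-scheme of finite type admits a
`Sing`-supported blow-up with regular source) and `X` an integral `k`-scheme of finite type:
every blow-up of `X` is empty (zero ideal) or an integral `k`-scheme of finite type, so
`admitsDesingularization_of_isBlowup_stalk` applies at every point.
[cite: Temkin2008, Def. 2.3.1, Prop. 2.3.4] -/
theorem admitsDesingularization_of_isBlowup_stalk_of_resolutionOver {k : Type u} [Field k]
    (hk : ResolutionOver (Spec (.of k))) {X : Scheme.{u}} [IsIntegral X]
    (f : X ⟶ Spec (.of k)) [LocallyOfFiniteType f] [QuasiCompact f] (x : X) {S' : Scheme.{u}}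
    {g : S' ⟶ Spec (X.presheaf.stalk x)} {I : (Spec (X.presheaf.stalk x)).IdealSheafData}
    (hg : IsBlowup g I) : Scheme.AdmitsDesingularization S' := by
  haveI : IsLocallyNoetherian X := LocallyOfFiniteType.isLocallyNoetherian f
  refine admitsDesingularization_of_isBlowup_stalk (fun X₁ b J hb => ?_) x hg
  by_cases hJ : J = ⊥
  · subst hJ
    haveI := hb.isEmpty_of_bot
    exact Scheme.admitsDesingularization_of_isEmpty X₁
  haveI : IsIntegral X₁ := hb.isIntegral hJ
  haveI : IsProper b := hb.isProper
  haveI : LocallyOfFiniteType (b ≫ f) := inferInstance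
  haveI : QuasiCompact (b ≫ f) := inferInstance
  exact hk X₁ (b ≫ f)

/-- **The kernel `stub_picoverKernel` of line `degree-p-tower` follows from Temkin-strong
resolution of singularities in characteristic `p`** (verbatim registered signature as the
conclusion): if for every prime `p` and every field `k` of characteristic `p` every integral
`k`-scheme of finite type admits a desingularization (`ResolutionOver (Spec k)`, Temkin 2008
Def. 2.3.1), then at every point `x` of `W^L = normalizationIn W L` (`W` integral separated of
finite type over `k`, `L/K(W)` finite) every blow-up of `Spec 𝒪_{W^L,x}` admits a
desingularization — the hypotheses "`x` singular", "local dimension `≥ 4`", "`S'` singular only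
over `x`", "`W` regular" and "`L/K(W)` purely inseparable" of the kernel are not used. Hence a
refutation of the kernel refutes resolution by `Sing`-supported blow-ups of some 4-dimensional
purely inseparable `p`-cover. [cite: Temkin2008, Def. 2.3.1, Prop. 2.3.4] -/
theorem picoverKernel_of_resolutionOver : (∀ (p : ℕ), p.Prime → ∀ (k : Type) [Field k] [CharP k p], ResolutionOver (Spec (.of k))) → ∀ (p : ℕ), p.Prime → ∀ (k : Type) [Field k] [CharP k p] (W : Scheme.{0}) [IsIntegral W] (f : W ⟶ Spec (.of k)) (L : Type) [Field L] [Algebra W.functionField L], IsSeparated f → LocallyOfFiniteType f → QuasiCompact f → Scheme.IsRegular W → IsPurelyInseparable W.functionField L → Module.finrank W.functionField L = p → ∀ x : normalizationIn W L, x ∉ Scheme.regularLocus (normalizationIn W L) → 4 ≤ ringKrullDim ((normalizationIn W L).presheaf.stalk x) → ∀ (S' : Scheme.{0}) (g : S' ⟶ Spec ((normalizationIn W L).presheaf.stalk x)) (I : (Spec ((normalizationIn W L).presheaf.stalk x)).IdealSheafData), IsBlowup g I → (∀ s : S', s ∉ Scheme.regularLocus S' → g s = IsLocalRing.closedPoint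 ((normalizationIn W L).presheaf.stalk x)) → Scheme.AdmitsDesingularization S' := by
  intro hR p hp k _ _ W _ f L _ _ _ hlft hqc _ _ hdeg x _ _ S' g I hg _
  haveI : FiniteDimensional W.functionField L :=
    Module.finite_of_finrank_pos (by rw [hdeg]; exact hp.pos)
  haveI : LocallyOfFiniteType f := hlft
  haveI : QuasiCompact f := hqc
  haveI : IsFinite (normalizationInι W L) := isFinite_normalizationInι W L f
  haveI : LocallyOfFiniteType (normalizationInι W L ≫ f) := inferInstance
  haveI : QuasiCompact (normalizationInι W L ≫ f) := inferInstance
  exact admitsDesingularization_of_isBlowup_stalk_of_resolutionOver (hR p hp k)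
    (normalizationInι W L ≫ f) x hg

/-! ## The fact-free variant of the reduction: kernel at every local dimension ⇒ residue -/

/-- **The residue `stub_picoverDegP` from Temkin's local hypothesis at ALL singular points of
`W^L`** (no Cossart–Piltant, no Cossart–Jannsen–Saito): if at every non-regular point `x` of
`W^L` (any local dimension) every blow-up of `Spec 𝒪_{W^L,x}` singular only over `x` admits a
desingularization, then `W^L` has a resolution — by the landed per-scheme localisation
`LocalBlowups.admitsDesingularization_of_localBlowups_over_field` (Temkin 2008 Prop. 2.3.4
(iii)⇒(ii) for one scheme over a field) and `Scheme.AdmitsDesingularization.hasResolution`.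
A planner who prefers ONE research stub and NO named facts reshapes the line with this in place
of `KernelReduction.stub_picoverDegP_of_facts_and_kernel`. [cite: Temkin2008, Prop. 2.3.4] -/
theorem picoverDegP_of_localBlowups_allDims : (∀ (p : ℕ), p.Prime → ∀ (k : Type) [Field k] [CharP k p] (W : Scheme.{0}) [IsIntegral W] (f : W ⟶ Spec (.of k)) (L : Type) [Field L] [Algebra W.functionField L], IsSeparated f → LocallyOfFiniteType f → QuasiCompact f → Scheme.IsRegular W → IsPurelyInseparable W.functionField L → Module.finrank W.functionField L = p → ∀ x : normalizationIn W L, x ∉ Scheme.regularLocus (normalizationIn W L) → ∀ (S' : Scheme.{0}) (g : S' ⟶ Spec ((normalizationIn W L).presheaf.stalk x)) (I : (Spec ((normalizationIn W L).presheaf.stalk x)).IdealSheafData), IsBlowup g I → (∀ s : S', s ∉ Scheme.regularLocus S' → g s = IsLocalRing.closedPoint ((normalizationIn W L).presheaf.stalk x)) → Scheme.AdmitsDesingularization S') → ∀ (p : ℕ), p.Prime → ∀ (k : Type) [Field k] [CharP k p] (W : Scheme.{0}) [IsIntegral W] (f : W ⟶ Spec (.of k)) (L : Type) [Field L] [Algebra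 W.functionField L], IsSeparated f → LocallyOfFiniteType f → QuasiCompact f → Scheme.IsRegular W → IsPurelyInseparable W.functionField L → Module.finrank W.functionField L = p → Scheme.HasResolution (normalizationIn W L) := by
  intro hK p hp k _ _ W _ f L _ _ hsep hlft hqc hreg hpi hdeg
  haveI : FiniteDimensional W.functionField L :=
    Module.finite_of_finrank_pos (by rw [hdeg]; exact hp.pos)
  haveI : LocallyOfFiniteType f := hlft
  haveI : QuasiCompact f := hqc
  haveI : IsFinite (normalizationInι W L) := isFinite_normalizationInι W L f
  haveI : LocallyOfFiniteType (normalizationInι W L ≫ f) := inferInstance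
  haveI : QuasiCompact (normalizationInι W L ≫ f) := inferInstance
  haveI : IsLocallyNoetherian (normalizationIn W L) :=
    LocallyOfFiniteType.isLocallyNoetherian (normalizationInι W L ≫ f)
  exact (Summit.ResolutionOfSingularities.ResolutionOfSingularities.Theorems.Picover.LocalBlowups.admitsDesingularization_of_localBlowups_over_field
    k (normalizationIn W L) (normalizationInι W L ≫ f)
    (fun x hx S' g I hg hsing => hK p hp k W f L hsep hlft hqc hreg hpi hdeg x hx S' g I hg hsing)).hasResolution

end Summit.ResolutionOfSingularities.ResolutionOfSingularities.Theorems.Picover.KernelHonesty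

end
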